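import Summits.HubbardSuperconductivity.HubbardSuperconductivity.Theorems.AnisotropyChordConcavityOneMagnonSector

/-!
# Route `AnisotropyChord`: the one-magnon sector of the spin-½ XXZ model on a finite graph, II —
# energy, norm and condensate in coordinates (support `Concavity` = stmt-HubbardSuperconductivity-8150)

Continuation of `…OneMagnonSector`.  For `ψ` in the sector `S^z_tot = |V|/2 − 1` of a finite simple
graph `G`, with amplitudes `v_i = ψ(Pi.single i 1) = a_i + i b_i`:

* `xxz_mulVec_single`: `(H(Δ)ψ)(i) = −Δ(|E|/4 − d_i/2) v_i − ½ Σ_{j∼i} v_j`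
  (`H(Δ)|₁ = −½(A − ΔD) − Δ|E|/4`);
* `re_energy_eq`, `re_norm_eq`: `Re⟨ψ,H(Δ)ψ⟩` and `‖ψ‖²` as the same real quadratic forms in `a`
  and in `b`; `energy_le_test`: the variational principle with a REAL one-magnon test vector;
  `re_energy_of_eigen`: the energy of a normalised eigenvector;
* `condensate_eq`: `Λ(ψ) = Re⟨ψ, S⁺_tot S⁻_tot ψ⟩ = (Σ_i a_i)² + (Σ_i b_i)² + 2(|V|/2 − 1)‖ψ‖²`
  (from `‖S⁻ψ‖² = ‖S⁺ψ‖² + 2M‖ψ‖²` and `S⁺_tot ψ = (Σ_i v_i)|all up⟩`);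
  `re_totalSpinSq_eq_condensate_add`: `Re⟨ψ, 𝐒²ψ⟩ = Λ(ψ) + (M² − M)‖ψ‖²` on any sector.

Used by `…OneMagnonDip` (the 13-vertex two-hub witness on which `Λ` of the sector ground state
DROPS between `Δ = −7/40` and `Δ = 3/8`).  H. Tasaki (2020) §2.4, App. A.3 eq. (A.3.6).
No definition is introduced.
-/

set_option linter.dupNamespace false

noncomputable section

namespace Summit.HubbardSuperconductivity.HubbardSuperconductivity.Theorems.AnisotropyChord.OneMagnon

open Matrix Complex Finset
open Literature.MathematicalPhysics.QuantumLattice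

section Coordinates

variable {V : Type*} [Fintype V] [DecidableEq V] (G : SimpleGraph V) [DecidableRel G.Adj]

/-- **`H(Δ)` on the one-magnon sector in coordinates**:
`(H(Δ)ψ)(i) = −Δ(|E|/4 − d_i/2)·ψ(i) − ½ Σ_{j ∼ i} ψ(j)`, i.e. `H(Δ)|₁ = −½(A − ΔD) − Δ|E|/4`.
Tasaki (2020) §2.4 (one-magnon states). [folklore] -/
theorem xxz_mulVec_single (Δ : ℝ) {ψ : (V → Fin 2) → ℂ}
    (hψ : ∀ σ : V → Fin 2, (∑ z, (σ z : ℕ)) ≠ 1 → ψ σ = 0) (i : V) :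
    ((xxzHamiltonian 1 G (-1) Δ : Op V 2) *ᵥ ψ) (Pi.single i 1) =
      -((Δ * ((G.edgeFinset.card : ℝ) / 4 - (G.degree i : ℝ) / 2) : ℝ) : ℂ) * ψ (Pi.single i 1)
        - (1 / 2 : ℂ) * ∑ j, (if G.Adj i j then ψ (Pi.single j 1) else 0) := by
  simp only [Matrix.mulVec, dotProduct]
  rw [sum_eq_sum_single (f := fun τ => (xxzHamiltonian 1 G (-1) Δ : Op V 2) (Pi.single i 1) τ * ψ τ)
    (fun τ hτ => by simp only [hψ τ hτ, mul_zero])]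
  have hterm : ∀ j, (xxzHamiltonian 1 G (-1) Δ : Op V 2) (Pi.single i 1) (Pi.single j 1) *
      ψ (Pi.single j 1) =
      (if j = i then -((Δ * ((G.edgeFinset.card : ℝ) / 4 - (G.degree i : ℝ) / 2) : ℝ) : ℂ) *
        ψ (Pi.single i 1) else 0) + -(1 / 2 : ℂ) * (if G.Adj i j then ψ (Pi.single j 1) else 0) := by
    intro j
    by_cases hji : j = i
    · subst hji
      rw [if_pos rfl, if_neg (SimpleGraph.irrefl G), xxz_apply_single_self, mul_zero, add_zero]
    · rw [if_neg hji, xxz_apply_single_single G Δ (Ne.symm hji), zero_add]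
      split_ifs <;> ring
  rw [Finset.sum_congr rfl (fun j _ => hterm j), Finset.sum_add_distrib, Finset.sum_ite_eq' Finset.univ i,
    if_pos (Finset.mem_univ i), ← Finset.mul_sum]
  ring

/-- `⟨ψ, H(Δ)ψ⟩` in one-magnon coordinates. [folklore] -/
theorem star_dotProduct_xxz_mulVec (Δ : ℝ) {ψ : (V → Fin 2) → ℂ}
    (hψ : ∀ σ : V → Fin 2, (∑ z, (σ z : ℕ)) ≠ 1 → ψ σ = 0) :
    star ψ ⬝ᵥ ((xxzHamiltonian 1 G (-1) Δ : Op V 2) *ᵥ ψ) =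
      ∑ i, star (ψ (Pi.single i 1)) *
        (-((Δ * ((G.edgeFinset.card : ℝ) / 4 - (G.degree i : ℝ) / 2) : ℝ) : ℂ) * ψ (Pi.single i 1)
          - (1 / 2 : ℂ) * ∑ j, (if G.Adj i j then ψ (Pi.single j 1) else 0)) := by
  rw [dotProduct, sum_eq_sum_single (f := fun σ => star ψ σ * ((xxzHamiltonian 1 G (-1) Δ : Op V 2) *ᵥ ψ) σ)
    (fun σ hσ => by simp only [Pi.star_apply, hψ σ hσ, star_zero, zero_mul])]
  exact Finset.sum_congr rfl fun i _ => by rw [Pi.star_apply, xxz_mulVec_single G Δ hψ i]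

/-- **Energy in coordinates** (`a = Re ψ(i)`, `b = Im ψ(i)`): real and imaginary parts enter through
the same real quadratic form `−Σ_i Δ(|E|/4 − d_i/2)x_i² − ½Σ_{i∼j} x_i x_j`. [folklore] -/
theorem re_energy_eq (Δ : ℝ) {ψ : (V → Fin 2) → ℂ}
    (hψ : ∀ σ : V → Fin 2, (∑ z, (σ z : ℕ)) ≠ 1 → ψ σ = 0) :
    (star ψ ⬝ᵥ ((xxzHamiltonian 1 G (-1) Δ : Op V 2) *ᵥ ψ)).re =
      ∑ i, (-(Δ * ((G.edgeFinset.card : ℝ) / 4 - (G.degree i : ℝ) / 2)) *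
          ((ψ (Pi.single i 1)).re ^ 2 + (ψ (Pi.single i 1)).im ^ 2)
        - (1 / 2) * ∑ j, (if G.Adj i j then
            ((ψ (Pi.single i 1)).re * (ψ (Pi.single j 1)).re +
              (ψ (Pi.single i 1)).im * (ψ (Pi.single j 1)).im) else 0)) := by
  rw [star_dotProduct_xxz_mulVec G Δ hψ, Complex.re_sum]
  refine Finset.sum_congr rfl fun i _ => ?_
  have h1 : ∀ (c : ℝ) (z : ℂ), (star z * (-(c : ℂ) * z)).re = -c * (z.re ^ 2 + z.im ^ 2) := by
    intro c z
    simp [Complex.mul_re, Complex.mul_im]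
    ring
  have h2 : ∀ z w : ℂ, (star z * ((1 / 2 : ℂ) * w)).re = (1 / 2) * (z.re * w.re + z.im * w.im) := by
    intro z w
    simp [Complex.mul_re, Complex.mul_im]
    ring
  rw [mul_sub, Complex.sub_re, h1, Finset.mul_sum, Finset.mul_sum, Complex.re_sum, Finset.mul_sum]
  congr 1
  refine Finset.sum_congr rfl fun j _ => ?_
  split_ifs
  · rw [h2]
  · simp

/-- **Norm in coordinates**: `‖ψ‖² = Σ_i (a_i² + b_i²)`. [folklore] -/
theorem re_norm_eq {ψ : (V → Fin 2) → ℂ}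
    (hψ : ∀ σ : V → Fin 2, (∑ z, (σ z : ℕ)) ≠ 1 → ψ σ = 0) :
    (star ψ ⬝ᵥ ψ).re = ∑ i, ((ψ (Pi.single i 1)).re ^ 2 + (ψ (Pi.single i 1)).im ^ 2) := by
  rw [dotProduct, sum_eq_sum_single (f := fun σ => star ψ σ * ψ σ)
    (fun σ hσ => by simp only [Pi.star_apply, hψ σ hσ, mul_zero]), Complex.re_sum]
  refine Finset.sum_congr rfl fun i _ => ?_
  rw [Pi.star_apply]
  simp [Complex.mul_re]
  ring

/-- **Variational principle with a real one-magnon test vector** `φ_y = Σ_i y_i|i⟩`: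
`E_min(sector) · Σ_i y_i² ≤ −Σ_i Δ(|E|/4 − d_i/2) y_i² − ½ Σ_{i∼j} y_i y_j`. [folklore] -/
theorem energy_le_test (Δ : ℝ) (y : V → ℝ) :
    lowestEnergyInSector 1 (xxzHamiltonian 1 G (-1) Δ) ((Fintype.card V : ℝ) / 2 - 1) * ∑ i, y i ^ 2 ≤
      ∑ i, (-(Δ * ((G.edgeFinset.card : ℝ) / 4 - (G.degree i : ℝ) / 2)) * y i ^ 2
        - (1 / 2) * ∑ j, (if G.Adj i j then y i * y j else 0)) := by
  have hsupp : ∀ σ : V → Fin 2, (∑ z, (σ z : ℕ)) ≠ 1 →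
      (∑ i, ((y i : ℝ) : ℂ) • (Pi.single (Pi.single i (1 : Fin 2)) (1 : ℂ) : (V → Fin 2) → ℂ)) σ = 0 :=
    fun σ hσ => testVec_apply_of_weight_ne y σ hσ
  have hval : ∀ i, (∑ i, ((y i : ℝ) : ℂ) • (Pi.single (Pi.single i (1 : Fin 2)) (1 : ℂ) :
      (V → Fin 2) → ℂ)) (Pi.single i 1) = (y i : ℂ) := fun i => testVec_apply_single y i
  have hmem := mem_oneMagnonSector_of_support hsupp
  have h := minEnergyOn_mul_le_re_rayleigh (xxzHamiltonian_isHermitian 1 G (-1) Δ) _ hmem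
  rw [re_norm_eq hsupp, re_energy_eq G Δ hsupp] at h
  simp only [hval, Complex.ofReal_re, Complex.ofReal_im] at h
  have e1 : (∑ i, (y i ^ 2 + (0 : ℝ) ^ 2)) = ∑ i, y i ^ 2 :=
    Finset.sum_congr rfl fun i _ => by ring
  have e2 : ∀ i, -(Δ * ((G.edgeFinset.card : ℝ) / 4 - (G.degree i : ℝ) / 2)) * (y i ^ 2 + (0 : ℝ) ^ 2)
      - (1 / 2) * ∑ j, (if G.Adj i j then y i * y j + 0 * 0 else 0) =
      -(Δ * ((G.edgeFinset.card : ℝ) / 4 - (G.degree i : ℝ) / 2)) * y i ^ 2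
        - (1 / 2) * ∑ j, (if G.Adj i j then y i * y j else 0) := fun i => by
    rw [Finset.sum_congr rfl (fun j _ => show (if G.Adj i j then y i * y j + 0 * 0 else (0 : ℝ)) =
      (if G.Adj i j then y i * y j else 0) by split_ifs <;> ring)]
    ring
  rw [e1, Finset.sum_congr rfl (fun i _ => e2 i)] at h
  exact h

/-- The energy of a normalised sector eigenvector at the sector energy is the sector energy (real
part form). [folklore] -/
theorem re_energy_of_eigen {E : ℝ} {A : Op V 2} {ψ : (V → Fin 2) → ℂ}
    (h1 : star ψ ⬝ᵥ ψ = 1) (hE : A *ᵥ ψ = ((E : ℝ) : ℂ) • ψ) :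
    (star ψ ⬝ᵥ (A *ᵥ ψ)).re = E := by
  rw [hE, dotProduct_smul, h1, smul_eq_mul, mul_one, Complex.ofReal_re]

end Coordinates

section Condensate

variable {V : Type*} [Fintype V] [DecidableEq V]

omit [DecidableEq V] in
/-- A nonzero configuration has positive weight. [folklore] -/
theorem weight_ne_zero_of_ne_zero {σ : V → Fin 2} (hσ : σ ≠ 0) : (∑ z, (σ z : ℕ)) ≠ 0 := by
  intro h
  apply hσ
  funext z
  have hz : (σ z : ℕ) = 0 := (Finset.sum_eq_zero_iff.mp h) z (Finset.mem_univ z)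
  exact Fin.ext hz

/-- **`S⁺_tot` on a one-magnon vector**: `S⁺_tot ψ = (Σ_i ψ(i))·|all up⟩`. Tasaki (2020) §2.4.
[folklore] -/
theorem raise_mulVec_eq {ψ : (V → Fin 2) → ℂ}
    (hψ : ∀ σ : V → Fin 2, (∑ z, (σ z : ℕ)) ≠ 1 → ψ σ = 0) :
    (totalSpin 1 0 + I • totalSpin 1 1 : Op V 2) *ᵥ ψ =
      Pi.single (0 : V → Fin 2) (∑ i, ψ (Pi.single i 1)) := by
  funext σ
  rw [LiebMattis.raise_mulVec_apply 1 ψ σ]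
  simp_rw [LiebMattis.sum_spinRaise_apply_mul 1 ψ σ]
  by_cases hσ : σ = 0
  · subst hσ
    rw [Pi.single_eq_same]
    refine Finset.sum_congr rfl fun x _ => ?_
    have hx : ((0 : V → Fin 2) x).val + 1 < 1 + 1 := by simp
    rw [dif_pos hx]
    have h1 : (⟨((0 : V → Fin 2) x).val + 1, hx⟩ : Fin 2) = 1 := Fin.ext (by simp)
    rw [h1]
    have hupd : Function.update (0 : V → Fin 2) x 1 = Pi.single x 1 := rfl
    rw [hupd]
    simp
  · rw [Pi.single_eq_of_ne hσ]
    refine Finset.sum_eq_zero fun x _ => ?_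
    by_cases hx : (σ x).val + 1 < 1 + 1
    · rw [dif_pos hx]
      have hx0 : (σ x : ℕ) = 0 := by omega
      have hw := weight_update σ x ⟨(σ x).val + 1, hx⟩
      have hval : ((⟨(σ x).val + 1, hx⟩ : Fin 2) : ℕ) = 1 := by
        show (σ x).val + 1 = 1
        omega
      have hne : (∑ z, ((Function.update σ x ⟨(σ x).val + 1, hx⟩) z : ℕ)) ≠ 1 := by
        have := weight_ne_zero_of_ne_zero hσ
        omega
      rw [hψ _ hne, mul_zero]
    · rw [dif_neg hx]

/-- `⟨ψ, S⁺_tot S⁻_tot ψ⟩ = ‖S⁻_tot ψ‖²` (in the ladder form used by `LiebMattis`). [folklore] -/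
theorem star_dotProduct_raiseLower_eq (ψ : (V → Fin 2) → ℂ) :
    star ψ ⬝ᵥ (((∑ x, onSite x (spinRaise 1)) * (∑ y, onSite y (spinLower 1)) : Op V 2) *ᵥ ψ) =
      star ((totalSpin 1 0 - I • totalSpin 1 1 : Op V 2) *ᵥ ψ) ⬝ᵥ
        ((totalSpin 1 0 - I • totalSpin 1 1 : Op V 2) *ᵥ ψ) := by
  rw [← LiebMattis.totalSpin_raise_eq_sum_onSite 1, ← LiebMattis.totalSpin_lower_eq_sum_onSite 1,
    ← Matrix.mulVec_mulVec, Matrix.dotProduct_mulVec, ← LiebMattis.conjTranspose_totalSpin_lower 1,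
    ← Matrix.star_mulVec]

/-- **The condensate in one-magnon coordinates**:
`Λ(ψ) = Re⟨ψ, S⁺_tot S⁻_tot ψ⟩ = (Σ_i a_i)² + (Σ_i b_i)² + 2(|V|/2 − 1)‖ψ‖²`
(`‖S⁻ψ‖² = ‖S⁺ψ‖² + 2M‖ψ‖²` on the sector `S^z_tot = M = |V|/2 − 1`, and `S⁺ψ = (Σ_i ψ(i))|⇑⟩`).
Tasaki (2020) App. A.3, eq. (A.3.6). [folklore] -/
theorem condensate_eq {ψ : (V → Fin 2) → ℂ}
    (hψ : ψ ∈ spinZSector (Λ := V) 1 ((Fintype.card V : ℝ) / 2 - 1)) :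
    (star ψ ⬝ᵥ (((∑ x, onSite x (spinRaise 1)) * (∑ y, onSite y (spinLower 1)) : Op V 2) *ᵥ ψ)).re =
      (∑ i, (ψ (Pi.single i 1)).re) ^ 2 + (∑ i, (ψ (Pi.single i 1)).im) ^ 2 +
        2 * ((Fintype.card V : ℝ) / 2 - 1) * (star ψ ⬝ᵥ ψ).re := by
  have hsupp := apply_eq_zero_of_mem_oneMagnonSector hψ
  rw [star_dotProduct_raiseLower_eq, LiebMattis.re_norm_lower_eq 1 hψ, raise_mulVec_eq hsupp]
  congr 1
  rw [dotProduct, Finset.sum_eq_single (0 : V → Fin 2)]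
  · rw [Pi.star_apply, Pi.single_eq_same]
    simp [Complex.mul_re, Complex.re_sum, Complex.im_sum]
    ring
  · intro σ _ hσ
    rw [Pi.single_eq_of_ne hσ, mul_zero]
  · intro h; exact absurd (Finset.mem_univ _) h

/-- **Total spin vs. condensate on a sector**: `Re⟨ψ, 𝐒²_tot ψ⟩ = Λ(ψ) + (M² − M)‖ψ‖²` for
`ψ` in the sector `S^z_tot = M` (so monotonicity of `⟨𝐒²_tot⟩` and of `Λ` in a parameter coincide
within a sector). Tasaki (2020) App. A.3, eq. (A.3.6). [folklore] -/
theorem re_totalSpinSq_eq_condensate_add {M : ℝ} {ψ : (V → Fin 2) → ℂ}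
    (hψ : ψ ∈ spinZSector (Λ := V) 1 M) :
    (star ψ ⬝ᵥ ((totalSpinSq 1 : Op V 2) *ᵥ ψ)).re =
      (star ψ ⬝ᵥ (((∑ x, onSite x (spinRaise 1)) * (∑ y, onSite y (spinLower 1)) : Op V 2) *ᵥ ψ)).re +
        (M * M - M) * (star ψ ⬝ᵥ ψ).re := by
  rw [LiebMattis.star_dotProduct_totalSpinSq_mulVec_lower 1 hψ, star_dotProduct_raiseLower_eq,
    Complex.add_re, Complex.re_ofReal_mul]

end Condensate

section Existence

variable {V : Type*} [Fintype V] [DecidableEq V] (G : SimpleGraph V) [DecidableRel G.Adj]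

/-- `H(Δ)` preserves the one-magnon support (it commutes with `S^z_tot`; entrywise: the Heisenberg
part preserves the weight and the Ising part is diagonal). [folklore] -/
theorem xxz_mulVec_apply_of_weight_ne (Δ : ℝ) {ψ : (V → Fin 2) → ℂ}
    (hψ : ∀ σ : V → Fin 2, (∑ z, (σ z : ℕ)) ≠ 1 → ψ σ = 0)
    (σ : V → Fin 2) (hσ : (∑ z, (σ z : ℕ)) ≠ 1) :
    ((xxzHamiltonian 1 G (-1) Δ : Op V 2) *ᵥ ψ) σ = 0 := by
  simp only [Matrix.mulVec, dotProduct]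
  refine Finset.sum_eq_zero fun τ _ => ?_
  by_cases hτ : (∑ z, (τ z : ℕ)) = 1
  · have hw : (∑ z, (σ z : ℕ)) ≠ ∑ z, (τ z : ℕ) := by rw [hτ]; exact hσ
    have hne : σ ≠ τ := fun h => hσ (h ▸ hτ)
    rw [xxz_eq_neg_heisenberg_add_diagonal, Matrix.add_apply, Matrix.neg_apply,
      LiebMattis.heisenbergHamiltonian_apply_eq_zero_of_weight_ne 1 G 1 hw, neg_zero, zero_add,
      diagonal_apply_ne _ hne, zero_mul]
  · rw [hψ τ hτ, mul_zero]

/-- **Existence of a normalised one-magnon sector ground state** on a nonempty graph: the sector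
`S^z_tot = |V|/2 − 1` is nonzero and invariant under `H(Δ)`, so `H(Δ)` has a normalised eigenvector
in it at the sector energy (`exists_unit_eigen_minEnergyOn`). [folklore] -/
theorem exists_oneMagnon_groundState [Nonempty V] (Δ : ℝ) :
    ∃ ψ : (V → Fin 2) → ℂ, ψ ∈ spinZSector (Λ := V) 1 ((Fintype.card V : ℝ) / 2 - 1) ∧
      star ψ ⬝ᵥ ψ = 1 ∧
      (xxzHamiltonian 1 G (-1) Δ : Op V 2) *ᵥ ψ =
        ((lowestEnergyInSector 1 (xxzHamiltonian 1 G (-1) Δ) ((Fintype.card V : ℝ) / 2 - 1) : ℝ) : ℂ)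
          • ψ := by
  have hinv : ∀ v ∈ spinZSector (Λ := V) 1 ((Fintype.card V : ℝ) / 2 - 1),
      (xxzHamiltonian 1 G (-1) Δ : Op V 2) *ᵥ v ∈ spinZSector (Λ := V) 1 ((Fintype.card V : ℝ) / 2 - 1) :=
    fun v hv => mem_oneMagnonSector_of_support
      (xxz_mulVec_apply_of_weight_ne G Δ (apply_eq_zero_of_mem_oneMagnonSector hv))
  have hne : spinZSector (Λ := V) 1 ((Fintype.card V : ℝ) / 2 - 1) ≠ ⊥ := by
    obtain ⟨i₀⟩ := ‹Nonempty V›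
    rw [Submodule.ne_bot_iff]
    refine ⟨Pi.single (Pi.single i₀ (1 : Fin 2)) (1 : ℂ), ?_, ?_⟩
    · refine mem_oneMagnonSector_of_support fun σ hσ => ?_
      rw [Pi.single_eq_of_ne]
      rintro rfl
      exact hσ (weight_single i₀)
    · intro h
      have := congrFun h (Pi.single i₀ 1)
      rw [Pi.single_eq_same, Pi.zero_apply] at this
      exact one_ne_zero this
  obtain ⟨ψ, hmem, h1, heig⟩ :=
    exists_unit_eigen_minEnergyOn (xxzHamiltonian_isHermitian 1 G (-1) Δ) _ hinv hne
  exact ⟨ψ, hmem, h1, heig⟩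

end Existence

end Summit.HubbardSuperconductivity.HubbardSuperconductivity.Theorems.AnisotropyChord.OneMagnon
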